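import Literature.NumberTheory.Automorphic.UnitaryGroupSingularBorelClass
import Literature.NumberTheory.Automorphic.UnitaryGroupBorelRefinedClassMap
import Literature.NumberTheory.Automorphic.UnitaryGroupKernelBorelClassHomogeneity
import HarnessLib

/-!
# The base point `γ₀ = ι(d(a,b,a))` of the singular Borel class of `U(J₃)`: its unipotent centraliser
# `N_{γ₀}(F)`, the one-point torus cell, and the class Borel kernel `K_{B,𝔬}(x,y) = ν(𝓕)⁻¹ ∫_{N(𝔸_F)} f(x⁻¹ γ₀ n y) dn`
(Rogawski, *Automorphic Representations of Unitary Groups in Three Variables* (1990), §2.2 p. 13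
(`K_{P,𝔬}(x, y) = Σ_{γ ∈ M_P ∩ 𝔬̲′} ∫_{𝐍_P} f(x⁻¹ γ n y) dn`), §7.2 pp. 91–92: (7.2.2) and Prop. 7.2.1, «Since `γ`
is singular, `𝒪_st ∩ M = {γ}`. We have `B_γ = M N_γ`»; Arthur, *A trace formula for reductive groups I*, Duke
Math. J. 45 (1978), §8.)

Topic `NumberTheory/Automorphic`; namespace `Literature.NumberTheory.Automorphic.UnitaryGroup`. THEOREMS
ONLY over accepted tree modules: no definition, no named fact, no instance, no notation, no `sorry`. Item
(L5-iii-b0), part 1 of 2, «pointwise regrouping of `K_{B,𝔬}` at the singular Borel class» of the T1-qs road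
(LAW 5 (iii)) of `Cruxes/H413/Lines/F0_T1InnerFormTraceIdentity.lean` (cell `pub/hodgecm-mathlib`, crux H413) —
the def-free ALGEBRAIC half of [Rogawski1990, (7.2.2) and Prop. 7.2.1] at the class (ii) «SINGULAR»
`i = (X − a)²(X − b)`, `a ≠ b ∈ E¹`, of ★ `meetsBorel_trichotomy`, refined by the Borel flag of ★
`UnitaryGroupBorelRefinedClassMap` to the class `i♭ = (i, true)` of the rational elements `G(F)`-conjugate into
`B(F)`; letters from ★ `UnitaryGroupSingularBorelClass` (the singular normal forms `d(a,b,a)·n(w)` and their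
rigidity). Quadratic `E/F` with involution `c`; `G = U(J₃)`, `G(F) =` ★ `arithmeticSubgroup`, `B(F) =` ★
`arithmeticBorel`, `N(𝔸_F) =` ★ `adelicUnipotent`, `N(F) =` ★ `rationalUnipotent`, `T(F) =` ★ `rationalTorus`.
The sequel ★-pending `UnitaryGroupKernelClassSingularBorel` treats `K_𝔬`; the measure-theoretic unfoldings (held
row (L5-iii-b)) and the evaluation [Prop. 7.2.2] are NOT here.

LETTERS (all inline, no definition). The class map is the Borel refinement
`cl♭ γ = (charpoly (adelicVal γ), decide (∃ δ ∈ G(F), δ γ δ⁻¹ ∈ B(F)))` of the characteristic-polynomial class map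
(★ `UnitaryGroupCharpolyClassMap`), written as the literal lambda of ★ `UnitaryGroupBorelRefinedClassMap`; the
class is `i♭ = (((X − C a)^2 (X − C b)).map (E → 𝔸_E), true)`. The BASE POINT is a rational element `g₀` with
matrix `d(a,b,a) = !![a, 0, 0; 0, b, 0; 0, 0, a]` (hypothesis `hg₀`), seen in `G(F)` as `γ₀` (hypothesis
`hγ₀ : ↑γ₀ = ι g₀`); its rational Borel centraliser is `B_{γ₀}(F) = B(F) ⊓ C(γ₀)` and the centre line of its
unipotent part is `N_{γ₀}(F) = (N(𝔸_F) ⊓ G(F)) ⊓ C(γ₀)` (`= {ι(n(w)) : w ∈ E⁰} = Z_N(F)`), both spelled with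
Mathlib's `Subgroup.centralizer`.

* §1 Base-point letters (every `N` where meaningful): **`toAdelic_injective_quasiSplit`**; products, inverses,
  equality, membership in `N(𝔸_F)` and commutation in `G(F)` read on rational matrices;
  **`exists_eq_heis_of_mem_unipotent_centralizer`** (`n ∈ N_{γ₀}(F)` is `ι(n(w))`, `w ∈ E⁰`, and `n γ₀` is the
  normal form `ι(d(a,b,a)·n(w))` — the root `α₁(γ₀) = a/b ≠ 1` kills the `x`-coordinate, ★
  `singularNormalForm_rigidity_entries`) and the converse **`exists_mem_unipotent_centralizer_mul_eq`**.
* §2 THE TORUS CELL IS A POINT: `γ₀ ∈ T(𝔸_F) ∩ B(F)` with refined class `i♭` (`borelRefine_basePoint`), and every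
  `t ∈ T(F)` with class `i♭` IS `γ₀` (**`coe_eq_basePoint_of_borelRefine_eq`**, ★
  `diag_eq_of_blockTriangular_of_charpoly_eq`: «`𝒪_st ∩ M = {γ}`»); `subsingleton_torusCell`.
* §3 (R1) **`borelSumClass_singular_eq_tsum_rationalUnipotent`**:
  `Σ_{β ∈ B(F), cl♭ β = i♭} f(x⁻¹ β y) = Σ_{n ∈ N(F)} f(x⁻¹ γ₀ n y)` (pure re-indexing through ★
  `exists_equiv_borelClassCell_prod`), and **`kernelBorelClass_singular_eq_smul_integral`**:
  `K_{B,i♭}(x, y) = ν(𝓕)⁻¹ · ∫_{N(𝔸_F)} f(x⁻¹ γ₀ m y) dν(m)` for `f ∈ C_c(G(𝔸_F))`, a Haar measure `ν` on `N(𝔸_F)` and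
  a fundamental domain `𝓕` of `N(F)` (★ `kernelBorelClass_eq_smul_tsum_integral` over the one-point cell) — print's
  `Σ_{γ″ ∈ 𝒪_st ∩ M} ∫_{𝐍} f(… γ″ n …) dn` with `𝒪_st ∩ M = {γ}`.

## References

* J. D. Rogawski, *Automorphic Representations of Unitary Groups in Three Variables*, Annals of
  Mathematics Studies 123 (1990), §2.2 (p. 13), §3.5–3.6 (pp. 25–27), §7.2 (pp. 91–92, 97) [Rogawski1990].
* J. Arthur, *A trace formula for reductive groups I: terms associated to classes in `G(ℚ)`*, Duke
  Math. J. 45 (1978), §8 [Arthur1978TraceFormulaI].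
-/

set_option autoImplicit false

noncomputable section

open MeasureTheory NumberField IsDedekindDomain Matrix Polynomial
open scoped Classical MatrixGroups

namespace Literature.NumberTheory.Automorphic

namespace UnitaryGroup

variable {F E : Type} [Field F] [NumberField F] [Field E] [NumberField E] [Algebra F E]
  {c : E ≃ₐ[F] E} {N : ℕ}

/-! ## §1 Base-point letters: `ι` is injective; `N_{γ₀}(F)` and `B_{γ₀}(F)` on matrices -/

section BasePoint

/-- The adelic matrix of `ι g` is the entrywise image of the rational matrix of `g` (definitional).
[folklore] -/
private theorem coe_adelicVal_toAdelic₉ (g : (quasiSplit F E c N).Rational) :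
    ((adelicVal F E c N _ ((quasiSplit F E c N).toAdelic g) : GL (Fin N) (AdeleRing (𝓞 E) E)) :
        Matrix (Fin N) (Fin N) (AdeleRing (𝓞 E) E)) =
      ((g.val : GL (Fin N) E) : Matrix (Fin N) (Fin N) E).map (algebraMap E (AdeleRing (𝓞 E) E)) :=
  rfl

/-- **`ι : U(J_N)(F) → U(J_N)(𝔸_F)` is injective** (`E → 𝔸_E` is injective, Mathlib
`AdeleRing.algebraMap_injective`). [cite: Rogawski1990, §1.9 (p. 9); §2.2 (p. 13)] -/
theorem toAdelic_injective_quasiSplit : Function.Injective (quasiSplit F E c N).toAdelic := by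
  intro g g' h
  have hm := congrArg (fun x : (quasiSplit F E c N).Adelic =>
    ((adelicVal F E c N _ x : GL (Fin N) (AdeleRing (𝓞 E) E)) : Matrix (Fin N) (Fin N) (AdeleRing (𝓞 E) E))) h
  simp only [coe_adelicVal_toAdelic₉] at hm
  exact Subtype.ext (Units.ext (Matrix.map_injective (AdeleRing.algebraMap_injective (𝓞 E) E) hm))

/-- Two rational elements with the same image in `G(F)` are equal; in particular an element of `G(F)`
has a UNIQUE rational matrix. [cite: Rogawski1990, §1.9 (p. 9); §2.2 (p. 13)] -/
theorem eq_of_toAdelic_eq {g g' : (quasiSplit F E c N).Rational}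
    (h : (quasiSplit F E c N).toAdelic g = (quasiSplit F E c N).toAdelic g') : g = g' :=
  toAdelic_injective_quasiSplit h

/-- The rational matrix of a product is the product of the rational matrices. [folklore] -/
private theorem coe_val_mul₉ (g h : (quasiSplit F E c N).Rational) :
    (((g * h).val : GL (Fin N) E) : Matrix (Fin N) (Fin N) E) =
      ((g.val : GL (Fin N) E) : Matrix (Fin N) (Fin N) E) * ((h.val : GL (Fin N) E) : Matrix (Fin N) (Fin N) E) := by
  rw [← Units.val_mul]; rfl

/-- The rational matrix of `1` is `1`. [folklore] -/
private theorem coe_val_one₉ :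
    (((1 : (quasiSplit F E c N).Rational).val : GL (Fin N) E) : Matrix (Fin N) (Fin N) E) = 1 := rfl

/-- The rational matrix of an inverse is the inverse matrix. [folklore] -/
private theorem coe_val_inv₉ (g : (quasiSplit F E c N).Rational) :
    (((g⁻¹).val : GL (Fin N) E) : Matrix (Fin N) (Fin N) E) =
      (((g.val : GL (Fin N) E) : Matrix (Fin N) (Fin N) E))⁻¹ := by
  rw [← Matrix.coe_units_inv]; rfl


/-! ### The base point `γ₀ = ι(d(a,b,a))`, its unipotent centraliser `N_{γ₀}(F)` and `B_{γ₀}(F)` -/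

/-- The base-point matrix `d(a,b,a)` is the singular normal form with corner `w = 0` (bridge to the
letters of ★ `UnitaryGroupSingularBorelClass`). [cite: Rogawski1990, §7.2 (pp. 91–92)] -/
theorem eq_singularNormalForm_zero_of_eq_diag {a b : Eˣ} {g₀ : (quasiSplit F E c 3).Rational}
    (hg₀ : ((g₀.val : GL (Fin 3) E) : Matrix (Fin 3) (Fin 3) E) = !![(a : E), 0, 0; 0, b, 0; 0, 0, a]) :
    ((g₀.val : GL (Fin 3) E) : Matrix (Fin 3) (Fin 3) E) = !![(a : E), 0, a * 0; 0, b, 0; 0, 0, a] := by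
  rw [hg₀, mul_zero]

/-- Every element of `G(F)` is `ι g` for a rational `g` (the arithmetic subgroup is the range of `ι`).
[cite: Rogawski1990, §1.9 (p. 9); §2.2 (p. 13)] -/
theorem exists_coe_eq_toAdelic (γ : (quasiSplit F E c N).arithmeticSubgroup) :
    ∃ g : (quasiSplit F E c N).Rational, (γ : (quasiSplit F E c N).Adelic) = (quasiSplit F E c N).toAdelic g := by
  obtain ⟨g, hg⟩ := γ.2
  exact ⟨g, hg.symm⟩

/-- Products in `G(F)` are read on rational preimages: `ι g · ι g' = ι (g g')`. [cite: Rogawski1990, §1.9 (p. 9); §2.2 (p. 13)] -/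
theorem coe_mul_eq_toAdelic_mul {γ γ' : (quasiSplit F E c N).arithmeticSubgroup}
    {g g' : (quasiSplit F E c N).Rational}
    (hγ : (γ : (quasiSplit F E c N).Adelic) = (quasiSplit F E c N).toAdelic g)
    (hγ' : (γ' : (quasiSplit F E c N).Adelic) = (quasiSplit F E c N).toAdelic g') :
    ((γ * γ' : (quasiSplit F E c N).arithmeticSubgroup) : (quasiSplit F E c N).Adelic) =
      (quasiSplit F E c N).toAdelic (g * g') := by
  rw [Subgroup.coe_mul, hγ, hγ', map_mul]

/-- Inverses in `G(F)` are read on rational preimages: `(ι g)⁻¹ = ι g⁻¹`. [cite: Rogawski1990, §1.9 (p. 9); §2.2 (p. 13)] -/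
theorem coe_inv_eq_toAdelic_inv {γ : (quasiSplit F E c N).arithmeticSubgroup} {g : (quasiSplit F E c N).Rational}
    (hγ : (γ : (quasiSplit F E c N).Adelic) = (quasiSplit F E c N).toAdelic g) :
    ((γ⁻¹ : (quasiSplit F E c N).arithmeticSubgroup) : (quasiSplit F E c N).Adelic) =
      (quasiSplit F E c N).toAdelic g⁻¹ := by
  rw [Subgroup.coe_inv, hγ, map_inv]

/-- **Equality in `G(F)` is equality of rational matrices** (through `ι`, injective). [cite: Rogawski1990, §1.9 (p. 9); §2.2 (p. 13)] -/
theorem eq_iff_val_eq_of_eq_toAdelic {γ γ' : (quasiSplit F E c N).arithmeticSubgroup}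
    {g g' : (quasiSplit F E c N).Rational}
    (hγ : (γ : (quasiSplit F E c N).Adelic) = (quasiSplit F E c N).toAdelic g)
    (hγ' : (γ' : (quasiSplit F E c N).Adelic) = (quasiSplit F E c N).toAdelic g') :
    γ = γ' ↔ ((g.val : GL (Fin N) E) : Matrix (Fin N) (Fin N) E) = ((g'.val : GL (Fin N) E) : Matrix (Fin N) (Fin N) E) := by
  constructor
  · intro h
    have h2 : (quasiSplit F E c N).toAdelic g = (quasiSplit F E c N).toAdelic g' := by rw [← hγ, ← hγ', h]
    rw [eq_of_toAdelic_eq h2]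
  · intro h
    have h2 : g = g' := Subtype.ext (Units.ext h)
    exact Subtype.ext (by rw [hγ, hγ', h2])

/-- An element of `G(F)` lies in `N(𝔸_F)` iff its rational matrix is upper unitriangular. [cite: Rogawski1990, §1.9 (p. 9); §2.2 (p. 13)] -/
theorem coe_mem_adelicUnipotent_iff_of_eq_toAdelic {γ : (quasiSplit F E c N).arithmeticSubgroup}
    {g : (quasiSplit F E c N).Rational}
    (hγ : (γ : (quasiSplit F E c N).Adelic) = (quasiSplit F E c N).toAdelic g) :
    (γ : (quasiSplit F E c N).Adelic) ∈ adelicUnipotent F E c N ↔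
      ((g.val : GL (Fin N) E) : Matrix (Fin N) (Fin N) E).BlockTriangular id ∧
        ∀ i, ((g.val : GL (Fin N) E) : Matrix (Fin N) (Fin N) E) i i = 1 := by
  rw [hγ, mem_adelicUnipotent_iff, mem_upperUnitriangular_iff, coe_adelicVal_toAdelic₉]
  have hinj := AdeleRing.algebraMap_injective (𝓞 E) E
  constructor
  · rintro ⟨hB, hd⟩
    refine ⟨fun i j hij => ?_, fun i => ?_⟩
    · have h0 := hB hij
      rw [Matrix.map_apply] at h0
      exact (map_eq_zero_iff _ hinj).1 h0
    · have h1 := hd i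
      rw [Matrix.map_apply] at h1
      exact hinj (by rw [h1, map_one])
  · rintro ⟨hB, hd⟩
    refine ⟨hB.map _, fun i => ?_⟩
    rw [Matrix.map_apply, hd, map_one]

/-- Two elements of `G(F)` commute iff their rational matrices commute. [cite: Rogawski1990, §1.9 (p. 9); §2.2 (p. 13)] -/
theorem commute_iff_of_eq_toAdelic {γ γ' : (quasiSplit F E c N).arithmeticSubgroup}
    {g g' : (quasiSplit F E c N).Rational}
    (hγ : (γ : (quasiSplit F E c N).Adelic) = (quasiSplit F E c N).toAdelic g)
    (hγ' : (γ' : (quasiSplit F E c N).Adelic) = (quasiSplit F E c N).toAdelic g') :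
    γ * γ' = γ' * γ ↔
      ((g.val : GL (Fin N) E) : Matrix (Fin N) (Fin N) E) * ((g'.val : GL (Fin N) E) : Matrix (Fin N) (Fin N) E) =
        ((g'.val : GL (Fin N) E) : Matrix (Fin N) (Fin N) E) * ((g.val : GL (Fin N) E) : Matrix (Fin N) (Fin N) E) := by
  rw [eq_iff_val_eq_of_eq_toAdelic (coe_mul_eq_toAdelic_mul hγ hγ') (coe_mul_eq_toAdelic_mul hγ' hγ),
    coe_val_mul₉, coe_val_mul₉]

/-- **Membership in the centraliser `C(γ₀)` of the base point**, read on rational matrices: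
`γ ∈ C(γ₀) ↔ [g, d(a,b,a)] = 0`. [cite: Rogawski1990, §7.2 (pp. 91–92)] -/
theorem mem_centralizer_iff_of_eq_toAdelic {a b : Eˣ} {g₀ : (quasiSplit F E c 3).Rational}
    {γ₀ : (quasiSplit F E c 3).arithmeticSubgroup}
    (hg₀ : ((g₀.val : GL (Fin 3) E) : Matrix (Fin 3) (Fin 3) E) = !![(a : E), 0, 0; 0, b, 0; 0, 0, a])
    (hγ₀ : (γ₀ : (quasiSplit F E c 3).Adelic) = (quasiSplit F E c 3).toAdelic g₀)
    {γ : (quasiSplit F E c 3).arithmeticSubgroup} {g : (quasiSplit F E c 3).Rational}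
    (hγ : (γ : (quasiSplit F E c 3).Adelic) = (quasiSplit F E c 3).toAdelic g) :
    γ ∈ Subgroup.centralizer ({γ₀} : Set (quasiSplit F E c 3).arithmeticSubgroup) ↔
      ((g.val : GL (Fin 3) E) : Matrix (Fin 3) (Fin 3) E) * !![(a : E), 0, 0; 0, b, 0; 0, 0, a] =
        !![(a : E), 0, 0; 0, b, 0; 0, 0, a] * ((g.val : GL (Fin 3) E) : Matrix (Fin 3) (Fin 3) E) := by
  rw [Subgroup.mem_centralizer_singleton_iff, commute_iff_of_eq_toAdelic hγ hγ₀, hg₀]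

/-- **THE RATIONAL CENTRE LINE `N_{γ₀}(F) = {ι(n(w)) : w ∈ E⁰}`**: an element of `G(F) ∩ N(𝔸_F)` commuting
with `γ₀ = ι(d(a,b,a))`, `a ≠ b`, is `ι u` with `u = n(w) = !![1, 0, w; 0, 1, 0; 0, 0, 1]` — the root
`α₁(γ₀) = a/b ≠ 1` kills the `x`-coordinate of the Heisenberg radical (★ `singularNormalForm_rigidity_entries`
at `w = w′ = 0`) — and `u · d(a,b,a) = d(a,b,a) · n(w)` is the singular normal form with corner `w`, `w ∈ E⁰`.
[cite: Rogawski1990, §7.2 (pp. 91–92, 97)] -/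
theorem exists_eq_heis_of_mem_unipotent_centralizer {a b : Eˣ} (hab : (a : E) ≠ (b : E))
    {g₀ : (quasiSplit F E c 3).Rational} {γ₀ : (quasiSplit F E c 3).arithmeticSubgroup}
    (hg₀ : ((g₀.val : GL (Fin 3) E) : Matrix (Fin 3) (Fin 3) E) = !![(a : E), 0, 0; 0, b, 0; 0, 0, a])
    (hγ₀ : (γ₀ : (quasiSplit F E c 3).Adelic) = (quasiSplit F E c 3).toAdelic g₀)
    {n : (quasiSplit F E c 3).arithmeticSubgroup}
    (hn : n ∈ (adelicUnipotent F E c 3).subgroupOf (quasiSplit F E c 3).arithmeticSubgroup ⊓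
      Subgroup.centralizer ({γ₀} : Set (quasiSplit F E c 3).arithmeticSubgroup)) :
    ∃ u : (quasiSplit F E c 3).Rational, ∃ w : E,
      ((u.val : GL (Fin 3) E) : Matrix (Fin 3) (Fin 3) E) = !![(1 : E), 0, w; 0, 1, 0; 0, 0, 1] ∧
      (n : (quasiSplit F E c 3).Adelic) = (quasiSplit F E c 3).toAdelic u ∧
      (((u * g₀).val : GL (Fin 3) E) : Matrix (Fin 3) (Fin 3) E) = !![(a : E), 0, a * w; 0, b, 0; 0, 0, a] ∧
      ((n * γ₀ : (quasiSplit F E c 3).arithmeticSubgroup) : (quasiSplit F E c 3).Adelic) =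
        (quasiSplit F E c 3).toAdelic (u * g₀) ∧
      w + c w = 0 := by
  obtain ⟨u, hu⟩ := exists_coe_eq_toAdelic n
  obtain ⟨hnU, hnC⟩ := Subgroup.mem_inf.1 hn
  obtain ⟨hB, hd⟩ := (coe_mem_adelicUnipotent_iff_of_eq_toAdelic hu).1 (Subgroup.mem_subgroupOf.1 hnU)
  have hcomm := (mem_centralizer_iff_of_eq_toAdelic hg₀ hγ₀ hu).1 hnC
  set U : Matrix (Fin 3) (Fin 3) E := ((u.val : GL (Fin 3) E) : Matrix (Fin 3) (Fin 3) E) with hUdef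
  have heq : U * !![(a : E), 0, a * 0; 0, b, 0; 0, 0, a] = !![(a : E), 0, a * 0; 0, b, 0; 0, 0, a] * U := by
    rw [mul_zero]; exact hcomm
  obtain ⟨h10, h21, h01, h12, -, -, -⟩ := singularNormalForm_rigidity_entries hab a.ne_zero heq
  have h20 : U 2 0 = 0 := hB (show ((0 : Fin 3) : Fin 3) < 2 by decide)
  have hUeq : U = !![(1 : E), 0, U 0 2; 0, 1, 0; 0, 0, 1] := by
    ext i j
    fin_cases i <;> fin_cases j <;> simp [h10, h21, h01, h12, h20, hd]
  have hmul : (((u * g₀).val : GL (Fin 3) E) : Matrix (Fin 3) (Fin 3) E) =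
      !![(a : E), 0, a * U 0 2; 0, b, 0; 0, 0, a] := by
    rw [coe_val_mul₉, ← hUdef, hUeq, hg₀]
    ext i j
    fin_cases i <;> fin_cases j <;> simp [Matrix.mul_apply, Fin.sum_univ_three]
    ring
  refine ⟨u, U 0 2, hUeq, hu, hmul, coe_mul_eq_toAdelic_mul hu hγ₀, ?_⟩
  exact (relations_of_eq_singularNormalForm hmul).2.2

/-- **Conversely every normal form gives an element of `N_{γ₀}(F)`**: if `g ∈ U(J₃)(F)` has matrix
`d(a,b,a)·n(w)` then there is `n ∈ N_{γ₀}(F)` with `n γ₀ = ι g` in `G(F)`, and `n = 1 ↔ w = 0`.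
[cite: Rogawski1990, §7.2 (pp. 91–92)] -/
theorem exists_mem_unipotent_centralizer_mul_eq {a b : Eˣ} {g₀ : (quasiSplit F E c 3).Rational}
    {γ₀ : (quasiSplit F E c 3).arithmeticSubgroup}
    (hg₀ : ((g₀.val : GL (Fin 3) E) : Matrix (Fin 3) (Fin 3) E) = !![(a : E), 0, 0; 0, b, 0; 0, 0, a])
    (hγ₀ : (γ₀ : (quasiSplit F E c 3).Adelic) = (quasiSplit F E c 3).toAdelic g₀)
    {g : (quasiSplit F E c 3).Rational} {w : E}
    (hg : ((g.val : GL (Fin 3) E) : Matrix (Fin 3) (Fin 3) E) = !![(a : E), 0, a * w; 0, b, 0; 0, 0, a]) :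
    ∃ n : (quasiSplit F E c 3).arithmeticSubgroup,
      n ∈ (adelicUnipotent F E c 3).subgroupOf (quasiSplit F E c 3).arithmeticSubgroup ⊓
        Subgroup.centralizer ({γ₀} : Set (quasiSplit F E c 3).arithmeticSubgroup) ∧
      n * γ₀ = ⟨(quasiSplit F E c 3).toAdelic g, g, rfl⟩ ∧ (n = 1 ↔ w = 0) := by
  obtain ⟨ha, hb, hw⟩ := relations_of_eq_singularNormalForm hg
  have h1 : c ((1 : Eˣ) : E) * ((1 : Eˣ) : E) = 1 := by rw [Units.val_one, map_one, mul_one]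
  obtain ⟨u, hu⟩ := exists_rational_eq_singularNormalForm (F := F) (c := c) (a := 1) (b := 1) h1 h1 hw
  rw [Units.val_one, one_mul] at hu
  set n : (quasiSplit F E c 3).arithmeticSubgroup := ⟨(quasiSplit F E c 3).toAdelic u, u, rfl⟩ with hndef
  have hnu : (n : (quasiSplit F E c 3).Adelic) = (quasiSplit F E c 3).toAdelic u := rfl
  have hmat : (((u * g₀).val : GL (Fin 3) E) : Matrix (Fin 3) (Fin 3) E) = !![(a : E), 0, a * w; 0, b, 0; 0, 0, a] := by
    rw [coe_val_mul₉, hu, hg₀]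
    ext i j
    fin_cases i <;> fin_cases j <;> simp [Matrix.mul_apply, Fin.sum_univ_three]
    ring
  refine ⟨n, Subgroup.mem_inf.2 ⟨?_, ?_⟩, ?_, ?_⟩
  · refine Subgroup.mem_subgroupOf.2 ((coe_mem_adelicUnipotent_iff_of_eq_toAdelic hnu).2 ⟨?_, ?_⟩)
    · intro i j hij
      rw [hu]
      fin_cases i <;> fin_cases j <;> simp_all
    · intro i
      rw [hu]
      fin_cases i <;> simp
  · rw [mem_centralizer_iff_of_eq_toAdelic hg₀ hγ₀ hnu, hu]
    ext i j
    fin_cases i <;> fin_cases j <;> simp [Matrix.mul_apply, Fin.sum_univ_three]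
    ring
  · rw [eq_iff_val_eq_of_eq_toAdelic (coe_mul_eq_toAdelic_mul hnu hγ₀) rfl, hmat, hg]
  · rw [eq_iff_val_eq_of_eq_toAdelic hnu (g' := 1) (by rw [map_one]; rfl), hu, coe_val_one₉]
    constructor
    · intro h
      have h02 := congrFun (congrFun h 0) 2
      simpa using h02
    · intro h
      rw [h]
      ext i j
      fin_cases i <;> fin_cases j <;> simp

end BasePoint

/-! ## §2 The torus cell of the singular Borel class is the point `γ₀` -/

section TorusCell

/-- **The base point lies in the adelic torus**: `γ₀ = ι(d(a,b,a)) ∈ T(𝔸_F)` (its adelic matrix is the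
diagonal of the principal idèles `(a, b, a)`). [cite: Rogawski1990, §1.9 (p. 9); §7.2 (p. 91)] -/
theorem coe_mem_torusAdelic_of_eq_diag {a b : Eˣ} {g₀ : (quasiSplit F E c 3).Rational} {γ₀ : (quasiSplit F E c 3).arithmeticSubgroup}
    (hg₀ : ((g₀.val : GL (Fin 3) E) : Matrix (Fin 3) (Fin 3) E) = !![(a : E), 0, 0; 0, b, 0; 0, 0, a])
    (hγ₀ : (γ₀ : (quasiSplit F E c 3).Adelic) = (quasiSplit F E c 3).toAdelic g₀) :
    (γ₀ : (quasiSplit F E c 3).Adelic) ∈ torusAdelic F E c 3 := by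
  refine ⟨fun i => Units.map (algebraMap E (AdeleRing (𝓞 E) E) : E →* AdeleRing (𝓞 E) E) (![a, b, a] i), ?_⟩
  refine Matrix.GeneralLinearGroup.ext fun i j => ?_
  change (glDiagonal 3 (AdeleRing (𝓞 E) E) _ : Matrix (Fin 3) (Fin 3) (AdeleRing (𝓞 E) E)) i j =
    ((adelicVal F E c 3 _ (γ₀ : (quasiSplit F E c 3).Adelic) : GL (Fin 3) (AdeleRing (𝓞 E) E)) :
      Matrix (Fin 3) (Fin 3) (AdeleRing (𝓞 E) E)) i j
  rw [hγ₀, coe_adelicVal_toAdelic₉, hg₀, coe_glDiagonal]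
  fin_cases i <;> fin_cases j <;> simp

/-- The base point lies in the rational Borel `B(F)`. [cite: Rogawski1990, §1.9 (p. 9); §7.2 (p. 91)] -/
theorem basePoint_mem_arithmeticBorel {a b : Eˣ} {g₀ : (quasiSplit F E c 3).Rational} {γ₀ : (quasiSplit F E c 3).arithmeticSubgroup}
    (hg₀ : ((g₀.val : GL (Fin 3) E) : Matrix (Fin 3) (Fin 3) E) = !![(a : E), 0, 0; 0, b, 0; 0, 0, a])
    (hγ₀ : (γ₀ : (quasiSplit F E c 3).Adelic) = (quasiSplit F E c 3).toAdelic g₀) :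
    γ₀ ∈ arithmeticBorel F E c 3 :=
  (mem_arithmeticBorel_iff _).2 (torusAdelic_le_borelAdelic (coe_mem_torusAdelic_of_eq_diag hg₀ hγ₀))

/-- The class of the base point is `(X − a)²(X − b)` (base change of ★ `charpoly_of_eq_singularNormalForm` at
`w = 0`). [cite: Rogawski1990, §7.2 (pp. 91–92)] -/
theorem charpoly_adelicVal_basePoint {a b : Eˣ} {g₀ : (quasiSplit F E c 3).Rational} {γ₀ : (quasiSplit F E c 3).arithmeticSubgroup}
    (hg₀ : ((g₀.val : GL (Fin 3) E) : Matrix (Fin 3) (Fin 3) E) = !![(a : E), 0, 0; 0, b, 0; 0, 0, a])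
    (hγ₀ : (γ₀ : (quasiSplit F E c 3).Adelic) = (quasiSplit F E c 3).toAdelic g₀) :
    ((adelicVal F E c 3 _ (γ₀ : (quasiSplit F E c 3).Adelic) : GL (Fin 3) (AdeleRing (𝓞 E) E)) :
        Matrix (Fin 3) (Fin 3) (AdeleRing (𝓞 E) E)).charpoly =
      ((X - C (a : E)) ^ 2 * (X - C (b : E))).map (algebraMap E (AdeleRing (𝓞 E) E)) := by
  rw [hγ₀]
  exact charpoly_adelicVal_toAdelic_of_eq_singularNormalForm (eq_singularNormalForm_zero_of_eq_diag hg₀)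

/-- **The refined class of the base point is `i♭ = ((X − a)²(X − b), true)`**: `γ₀` is a rational Borel
element with characteristic polynomial `(X − a)²(X − b)`. [cite: Rogawski1990, §7.2 (pp. 91–92)] -/
theorem borelRefine_basePoint {a b : Eˣ} {g₀ : (quasiSplit F E c 3).Rational} {γ₀ : (quasiSplit F E c 3).arithmeticSubgroup}
    (hg₀ : ((g₀.val : GL (Fin 3) E) : Matrix (Fin 3) (Fin 3) E) = !![(a : E), 0, 0; 0, b, 0; 0, 0, a])
    (hγ₀ : (γ₀ : (quasiSplit F E c 3).Adelic) = (quasiSplit F E c 3).toAdelic g₀) :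
    (fun γ : (quasiSplit F E c 3).arithmeticSubgroup => (((adelicVal F E c 3 _ (γ : (quasiSplit F E c 3).Adelic) :
          GL (Fin 3) (AdeleRing (𝓞 E) E)) : Matrix (Fin 3) (Fin 3) (AdeleRing (𝓞 E) E)).charpoly,
        decide (∃ δ : (quasiSplit F E c 3).arithmeticSubgroup, δ * γ * δ⁻¹ ∈ arithmeticBorel F E c 3))) γ₀ =
              ((Polynomial.map (algebraMap E (AdeleRing (𝓞 E) E)) ((X - C (a : E)) ^ 2 * (X - C (b : E)))), true) := by
  simp only [Prod.mk.injEq, decide_eq_true_eq]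
  exact ⟨charpoly_adelicVal_basePoint hg₀ hγ₀,
    exists_conj_mem_arithmeticBorel_of_mem (basePoint_mem_arithmeticBorel hg₀ hγ₀)⟩

/-- **THE TORUS CELL IS A POINT** («since `γ` is singular, `𝒪_st ∩ M = {γ}`»): a rational torus element
`t ∈ T(F)` whose class is `(X − a)²(X − b)` IS the base point, `t = γ₀ = ι(d(a,b,a))` — a diagonal rational
element with that characteristic polynomial, `a ≠ b ∈ E¹`, has diagonal `(a, b, a)` (★
`diag_eq_of_blockTriangular_of_charpoly_eq`). [cite: Rogawski1990, §7.2 Prop. 7.2.1 proof (p. 92)] -/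
theorem coe_eq_basePoint_of_charpoly_eq {a b : Eˣ} {g₀ : (quasiSplit F E c 3).Rational} {γ₀ : (quasiSplit F E c 3).arithmeticSubgroup}
    (hg₀ : ((g₀.val : GL (Fin 3) E) : Matrix (Fin 3) (Fin 3) E) = !![(a : E), 0, 0; 0, b, 0; 0, 0, a])
    (hγ₀ : (γ₀ : (quasiSplit F E c 3).Adelic) = (quasiSplit F E c 3).toAdelic g₀) (hab : (a : E) ≠ (b : E))
    (ha : c (a : E) * (a : E) = 1) (hb : c (b : E) * (b : E) = 1) (t : rationalTorus F E c 3)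
    (hcl : ((adelicVal F E c 3 _ ((t : torusAdelic F E c 3) : (quasiSplit F E c 3).Adelic) : GL (Fin 3) (AdeleRing (𝓞 E) E)) :
        Matrix (Fin 3) (Fin 3) (AdeleRing (𝓞 E) E)).charpoly =
      ((X - C (a : E)) ^ 2 * (X - C (b : E))).map (algebraMap E (AdeleRing (𝓞 E) E))) :
    ((t : torusAdelic F E c 3) : (quasiSplit F E c 3).Adelic) = (γ₀ : (quasiSplit F E c 3).Adelic) := by
  obtain ⟨β, hβ⟩ := exists_coe_eq_toAdelic (⟨((t : torusAdelic F E c 3) : (quasiSplit F E c 3).Adelic), t.2⟩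
        : (quasiSplit F E c 3).arithmeticSubgroup)
  change ((t : torusAdelic F E c 3) : (quasiSplit F E c 3).Adelic) = (quasiSplit F E c 3).toAdelic β at hβ
  obtain ⟨d, -, hd⟩ := (mem_torusAdelic_iff _).1 (t : torusAdelic F E c 3).2
  have hmap : ((β.val : GL (Fin 3) E) : Matrix (Fin 3) (Fin 3) E).map (algebraMap E (AdeleRing (𝓞 E) E)) =
      Matrix.diagonal fun i => (d i : AdeleRing (𝓞 E) E) := by
    rw [← coe_adelicVal_toAdelic₉, ← hβ, ← hd, coe_glDiagonal]
  have hoff : ∀ i j, i ≠ j → ((β.val : GL (Fin 3) E) : Matrix (Fin 3) (Fin 3) E) i j = 0 := by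
    intro i j hij
    have h := congrFun (congrFun hmap i) j
    rw [Matrix.map_apply, Matrix.diagonal_apply_ne _ hij] at h
    exact (map_eq_zero_iff _ (AdeleRing.algebraMap_injective (𝓞 E) E)).1 h
  have hB : ((β.val : GL (Fin 3) E) : Matrix (Fin 3) (Fin 3) E).BlockTriangular id :=
    fun i j hij => hoff i j (ne_of_gt hij)
  have hp : ((β.val : GL (Fin 3) E) : Matrix (Fin 3) (Fin 3) E).charpoly = (X - C (a : E)) ^ 2 * (X - C (b : E)) := by
    apply Polynomial.map_injective _ (AdeleRing.algebraMap_injective (𝓞 E) E)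
    rw [← charpoly_adelicVal_toAdelic, ← hβ]
    exact hcl
  obtain ⟨h00, h11, h22⟩ := diag_eq_of_blockTriangular_of_charpoly_eq hab ha hb hB hp
  have h01 := hoff 0 1 (by decide)
  have h02 := hoff 0 2 (by decide)
  have h10 := hoff 1 0 (by decide)
  have h12 := hoff 1 2 (by decide)
  have h20 := hoff 2 0 (by decide)
  have h21 := hoff 2 1 (by decide)
  have hval : ((β.val : GL (Fin 3) E) : Matrix (Fin 3) (Fin 3) E) = ((g₀.val : GL (Fin 3) E) : Matrix (Fin 3) (Fin 3) E) := by
    rw [hg₀]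
    ext i j
    fin_cases i <;> fin_cases j <;> simp [h00, h11, h22, h01, h02, h10, h12, h20, h21]
  have hβg : β = g₀ := Subtype.ext (Units.ext hval)
  rw [hβ, hβg, hγ₀]

/-- The same, keyed on the refined class: a torus element of refined class `i♭` is `γ₀`.
[cite: Rogawski1990, §7.2 Prop. 7.2.1 proof (p. 92)] -/
theorem coe_eq_basePoint_of_borelRefine_eq {a b : Eˣ} {g₀ : (quasiSplit F E c 3).Rational} {γ₀ : (quasiSplit F E c 3).arithmeticSubgroup}
    (hg₀ : ((g₀.val : GL (Fin 3) E) : Matrix (Fin 3) (Fin 3) E) = !![(a : E), 0, 0; 0, b, 0; 0, 0, a])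
    (hγ₀ : (γ₀ : (quasiSplit F E c 3).Adelic) = (quasiSplit F E c 3).toAdelic g₀) (hab : (a : E) ≠ (b : E))
    (ha : c (a : E) * (a : E) = 1) (hb : c (b : E) * (b : E) = 1) (t : rationalTorus F E c 3)
    (ht : (fun γ : (quasiSplit F E c 3).arithmeticSubgroup => (((adelicVal F E c 3 _ (γ : (quasiSplit F E c 3).Adelic) :
          GL (Fin 3) (AdeleRing (𝓞 E) E)) : Matrix (Fin 3) (Fin 3) (AdeleRing (𝓞 E) E)).charpoly,
        decide (∃ δ : (quasiSplit F E c 3).arithmeticSubgroup, δ * γ * δ⁻¹ ∈ arithmeticBorel F E c 3)))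
              ⟨((t : torusAdelic F E c 3) : (quasiSplit F E c 3).Adelic), t.2⟩ =
                    ((Polynomial.map (algebraMap E (AdeleRing (𝓞 E) E)) ((X - C (a : E)) ^ 2 * (X - C (b : E)))), true)) :
    ((t : torusAdelic F E c 3) : (quasiSplit F E c 3).Adelic) = (γ₀ : (quasiSplit F E c 3).Adelic) := by
  have ht' := ht
  simp only [Prod.mk.injEq, decide_eq_true_eq] at ht'
  exact coe_eq_basePoint_of_charpoly_eq hg₀ hγ₀ hab ha hb t ht'.1

/-- The torus cell `{t ∈ T(F) | cl♭ t = i♭}` is non-empty: it contains (the torus copy of) `γ₀`.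
[cite: Rogawski1990, §7.2 (pp. 91–92)] -/
theorem exists_torusCell_coe_eq_basePoint {a b : Eˣ} {g₀ : (quasiSplit F E c 3).Rational} {γ₀ : (quasiSplit F E c 3).arithmeticSubgroup}
    (hg₀ : ((g₀.val : GL (Fin 3) E) : Matrix (Fin 3) (Fin 3) E) = !![(a : E), 0, 0; 0, b, 0; 0, 0, a])
    (hγ₀ : (γ₀ : (quasiSplit F E c 3).Adelic) = (quasiSplit F E c 3).toAdelic g₀) :
    ∃ t : {t : rationalTorus F E c 3 // (fun γ : (quasiSplit F E c 3).arithmeticSubgroup => (((adelicVal F E c 3 _ (γ : (quasiSplit F E c 3).Adelic) :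
          GL (Fin 3) (AdeleRing (𝓞 E) E)) : Matrix (Fin 3) (Fin 3) (AdeleRing (𝓞 E) E)).charpoly,
        decide (∃ δ : (quasiSplit F E c 3).arithmeticSubgroup, δ * γ * δ⁻¹ ∈ arithmeticBorel F E c 3)))
              ⟨((t : torusAdelic F E c 3) : (quasiSplit F E c 3).Adelic), t.2⟩ =
                    ((Polynomial.map (algebraMap E (AdeleRing (𝓞 E) E)) ((X - C (a : E)) ^ 2 * (X - C (b : E)))), true)},
      (((t : rationalTorus F E c 3) : torusAdelic F E c 3) : (quasiSplit F E c 3).Adelic) = (γ₀ : (quasiSplit F E c 3).Adelic) :=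
  ⟨⟨⟨⟨(γ₀ : (quasiSplit F E c 3).Adelic), coe_mem_torusAdelic_of_eq_diag hg₀ hγ₀⟩, γ₀.2⟩, borelRefine_basePoint hg₀ hγ₀⟩, rfl⟩

/-- The torus cell `{t ∈ T(F) | cl♭ t = i♭}` has at most one element. [cite: Rogawski1990, §7.2 (pp. 91–92)] -/
theorem subsingleton_torusCell {a b : Eˣ} {g₀ : (quasiSplit F E c 3).Rational} {γ₀ : (quasiSplit F E c 3).arithmeticSubgroup}
    (hg₀ : ((g₀.val : GL (Fin 3) E) : Matrix (Fin 3) (Fin 3) E) = !![(a : E), 0, 0; 0, b, 0; 0, 0, a])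
    (hγ₀ : (γ₀ : (quasiSplit F E c 3).Adelic) = (quasiSplit F E c 3).toAdelic g₀) (hab : (a : E) ≠ (b : E))
    (ha : c (a : E) * (a : E) = 1) (hb : c (b : E) * (b : E) = 1) :
    Subsingleton {t : rationalTorus F E c 3 // (fun γ : (quasiSplit F E c 3).arithmeticSubgroup =>
          (((adelicVal F E c 3 _ (γ : (quasiSplit F E c 3).Adelic) :
          GL (Fin 3) (AdeleRing (𝓞 E) E)) : Matrix (Fin 3) (Fin 3) (AdeleRing (𝓞 E) E)).charpoly,
        decide (∃ δ : (quasiSplit F E c 3).arithmeticSubgroup, δ * γ * δ⁻¹ ∈ arithmeticBorel F E c 3)))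
              ⟨((t : torusAdelic F E c 3) : (quasiSplit F E c 3).Adelic), t.2⟩ =
                    ((Polynomial.map (algebraMap E (AdeleRing (𝓞 E) E)) ((X - C (a : E)) ^ 2 * (X - C (b : E)))), true)} :=
  ⟨fun t t' => Subtype.ext (Subtype.ext (Subtype.ext
    ((coe_eq_basePoint_of_borelRefine_eq hg₀ hγ₀ hab ha hb t.1 t.2).trans
      (coe_eq_basePoint_of_borelRefine_eq hg₀ hγ₀ hab ha hb t'.1 t'.2).symm)))⟩

end TorusCell

/-! ## §3 (R1) `K_{B,𝔬}` at the singular Borel class: the Borel class sum and its constant term -/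

section BorelKernel

/-- **THE CLASS BOREL SUM AT THE SINGULAR BOREL CLASS IS THE SUM OVER `γ₀ N(F)`**:
`Σ_{β ∈ B(F), cl♭ β = i♭} f(x⁻¹ β y) = Σ_{n ∈ N(F)} f(x⁻¹ γ₀ n y)` for EVERY `f` and all `x, y` — a pure
re-indexing: the class cell of `B(F)` over `i♭` is `{γ₀} × N(F)` (★ `exists_equiv_borelClassCell_prod` for the
`N(F)`-saturated class map `cl♭`, ★ `isUnipotentInvariantOnBorel_borelRefine`, and §2), i.e. `B(F) ∩ 𝔬 = γ N(F)`
[Rogawski1990, (7.2.2): `γ″` ranges over `𝒪_st ∩ M = {γ}`]. [cite: Rogawski1990, §2.2 (p. 13); §7.2 (pp. 91–92)] -/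
theorem borelSumClass_singular_eq_tsum_rationalUnipotent {a b : Eˣ} {g₀ : (quasiSplit F E c 3).Rational}
      {γ₀ : (quasiSplit F E c 3).arithmeticSubgroup}
    (hg₀ : ((g₀.val : GL (Fin 3) E) : Matrix (Fin 3) (Fin 3) E) = !![(a : E), 0, 0; 0, b, 0; 0, 0, a])
    (hγ₀ : (γ₀ : (quasiSplit F E c 3).Adelic) = (quasiSplit F E c 3).toAdelic g₀) (hab : (a : E) ≠ (b : E))
    (ha : c (a : E) * (a : E) = 1) (hb : c (b : E) * (b : E) = 1)
    (f : (quasiSplit F E c 3).Adelic → ℂ) (x y : (quasiSplit F E c 3).Adelic) :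
    borelSumClass (fun γ : (quasiSplit F E c 3).arithmeticSubgroup => (((adelicVal F E c 3 _ (γ : (quasiSplit F E c 3).Adelic) :
          GL (Fin 3) (AdeleRing (𝓞 E) E)) : Matrix (Fin 3) (Fin 3) (AdeleRing (𝓞 E) E)).charpoly,
        decide (∃ δ : (quasiSplit F E c 3).arithmeticSubgroup, δ * γ * δ⁻¹ ∈ arithmeticBorel F E c 3)))
              ((Polynomial.map (algebraMap E (AdeleRing (𝓞 E) E)) ((X - C (a : E)) ^ 2 * (X - C (b : E)))), true) f x y =
      ∑' n : rationalUnipotent F E c 3,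
        f (x⁻¹ * (γ₀ : (quasiSplit F E c 3).Adelic) * ((n : adelicUnipotent F E c 3) : (quasiSplit F E c 3).Adelic) * y) := by
  have hclN : IsUnipotentInvariantOnBorel F E c 3 (fun γ : (quasiSplit F E c 3).arithmeticSubgroup =>
        (((adelicVal F E c 3 _ (γ : (quasiSplit F E c 3).Adelic) :
          GL (Fin 3) (AdeleRing (𝓞 E) E)) : Matrix (Fin 3) (Fin 3) (AdeleRing (𝓞 E) E)).charpoly,
        decide (∃ δ : (quasiSplit F E c 3).arithmeticSubgroup, δ * γ * δ⁻¹ ∈ arithmeticBorel F E c 3))) :=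
    isUnipotentInvariantOnBorel_borelRefine isUnipotentInvariantOnBorel_charpoly_adelicVal
  obtain ⟨e, he⟩ :
      ∃ e : ((fun β : arithmeticBorel F E c 3 => (fun γ : (quasiSplit F E c 3).arithmeticSubgroup =>
            (((adelicVal F E c 3 _ (γ : (quasiSplit F E c 3).Adelic) :
          GL (Fin 3) (AdeleRing (𝓞 E) E)) : Matrix (Fin 3) (Fin 3) (AdeleRing (𝓞 E) E)).charpoly,
        decide (∃ δ : (quasiSplit F E c 3).arithmeticSubgroup, δ * γ * δ⁻¹ ∈ arithmeticBorel F E c 3))) β) ⁻¹'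
              {((Polynomial.map (algebraMap E (AdeleRing (𝓞 E) E)) ((X - C (a : E)) ^ 2 * (X - C (b : E)))), true)}) ≃
          {t : rationalTorus F E c 3 // (fun γ : (quasiSplit F E c 3).arithmeticSubgroup => (((adelicVal F E c 3 _ (γ : (quasiSplit F E c 3).Adelic) :
          GL (Fin 3) (AdeleRing (𝓞 E) E)) : Matrix (Fin 3) (Fin 3) (AdeleRing (𝓞 E) E)).charpoly,
        decide (∃ δ : (quasiSplit F E c 3).arithmeticSubgroup, δ * γ * δ⁻¹ ∈ arithmeticBorel F E c 3)))
              ⟨((t : torusAdelic F E c 3) : (quasiSplit F E c 3).Adelic), t.2⟩ =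
                    ((Polynomial.map (algebraMap E (AdeleRing (𝓞 E) E)) ((X - C (a : E)) ^ 2 * (X - C (b : E)))), true)} ×
            rationalUnipotent F E c 3,
        ∀ p, ((((e.symm p : (fun β : arithmeticBorel F E c 3 => (fun γ : (quasiSplit F E c 3).arithmeticSubgroup =>
              (((adelicVal F E c 3 _ (γ : (quasiSplit F E c 3).Adelic) :
          GL (Fin 3) (AdeleRing (𝓞 E) E)) : Matrix (Fin 3) (Fin 3) (AdeleRing (𝓞 E) E)).charpoly,
        decide (∃ δ : (quasiSplit F E c 3).arithmeticSubgroup, δ * γ * δ⁻¹ ∈ arithmeticBorel F E c 3))) β) ⁻¹'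
              {((Polynomial.map (algebraMap E (AdeleRing (𝓞 E) E)) ((X - C (a : E)) ^ 2 * (X - C (b : E)))), true)}) :
            arithmeticBorel F E c 3) : (quasiSplit F E c 3).arithmeticSubgroup) : (quasiSplit F E c 3).Adelic) =
          ((p.1.1 : torusAdelic F E c 3) : (quasiSplit F E c 3).Adelic) * ((p.2 : adelicUnipotent F E c 3) : (quasiSplit F E c 3).Adelic) :=
    exists_equiv_borelClassCell_prod hclN _
  obtain ⟨t₀, -⟩ := exists_torusCell_coe_eq_basePoint hg₀ hγ₀
  haveI := subsingleton_torusCell hg₀ hγ₀ hab ha hb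
  haveI : Unique {t : rationalTorus F E c 3 // (fun γ : (quasiSplit F E c 3).arithmeticSubgroup =>
        (((adelicVal F E c 3 _ (γ : (quasiSplit F E c 3).Adelic) :
          GL (Fin 3) (AdeleRing (𝓞 E) E)) : Matrix (Fin 3) (Fin 3) (AdeleRing (𝓞 E) E)).charpoly,
        decide (∃ δ : (quasiSplit F E c 3).arithmeticSubgroup, δ * γ * δ⁻¹ ∈ arithmeticBorel F E c 3)))
              ⟨((t : torusAdelic F E c 3) : (quasiSplit F E c 3).Adelic), t.2⟩ =
                    ((Polynomial.map (algebraMap E (AdeleRing (𝓞 E) E)) ((X - C (a : E)) ^ 2 * (X - C (b : E)))), true)} :=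
    uniqueOfSubsingleton t₀
  have hpt : ∀ t : {t : rationalTorus F E c 3 // (fun γ : (quasiSplit F E c 3).arithmeticSubgroup =>
        (((adelicVal F E c 3 _ (γ : (quasiSplit F E c 3).Adelic) :
          GL (Fin 3) (AdeleRing (𝓞 E) E)) : Matrix (Fin 3) (Fin 3) (AdeleRing (𝓞 E) E)).charpoly,
        decide (∃ δ : (quasiSplit F E c 3).arithmeticSubgroup, δ * γ * δ⁻¹ ∈ arithmeticBorel F E c 3)))
              ⟨((t : torusAdelic F E c 3) : (quasiSplit F E c 3).Adelic), t.2⟩ =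
                    ((Polynomial.map (algebraMap E (AdeleRing (𝓞 E) E)) ((X - C (a : E)) ^ 2 * (X - C (b : E)))), true)},
      (((t : rationalTorus F E c 3) : torusAdelic F E c 3) : (quasiSplit F E c 3).Adelic) = (γ₀ : (quasiSplit F E c 3).Adelic) := fun t =>
    coe_eq_basePoint_of_borelRefine_eq hg₀ hγ₀ hab ha hb t.1 t.2
  calc borelSumClass (fun γ : (quasiSplit F E c 3).arithmeticSubgroup => (((adelicVal F E c 3 _ (γ : (quasiSplit F E c 3).Adelic) :
          GL (Fin 3) (AdeleRing (𝓞 E) E)) : Matrix (Fin 3) (Fin 3) (AdeleRing (𝓞 E) E)).charpoly,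
        decide (∃ δ : (quasiSplit F E c 3).arithmeticSubgroup, δ * γ * δ⁻¹ ∈ arithmeticBorel F E c 3)))
              ((Polynomial.map (algebraMap E (AdeleRing (𝓞 E) E)) ((X - C (a : E)) ^ 2 * (X - C (b : E)))), true) f x y
      = ∑' p : {t : rationalTorus F E c 3 // (fun γ : (quasiSplit F E c 3).arithmeticSubgroup =>
            (((adelicVal F E c 3 _ (γ : (quasiSplit F E c 3).Adelic) :
          GL (Fin 3) (AdeleRing (𝓞 E) E)) : Matrix (Fin 3) (Fin 3) (AdeleRing (𝓞 E) E)).charpoly,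
        decide (∃ δ : (quasiSplit F E c 3).arithmeticSubgroup, δ * γ * δ⁻¹ ∈ arithmeticBorel F E c 3)))
              ⟨((t : torusAdelic F E c 3) : (quasiSplit F E c 3).Adelic), t.2⟩ =
                    ((Polynomial.map (algebraMap E (AdeleRing (𝓞 E) E)) ((X - C (a : E)) ^ 2 * (X - C (b : E)))), true)} ×
            rationalUnipotent F E c 3,
          f (x⁻¹ * ((((e.symm p : (fun β : arithmeticBorel F E c 3 => (fun γ : (quasiSplit F E c 3).arithmeticSubgroup =>
                (((adelicVal F E c 3 _ (γ : (quasiSplit F E c 3).Adelic) :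
          GL (Fin 3) (AdeleRing (𝓞 E) E)) : Matrix (Fin 3) (Fin 3) (AdeleRing (𝓞 E) E)).charpoly,
        decide (∃ δ : (quasiSplit F E c 3).arithmeticSubgroup, δ * γ * δ⁻¹ ∈ arithmeticBorel F E c 3))) β) ⁻¹'
              {((Polynomial.map (algebraMap E (AdeleRing (𝓞 E) E)) ((X - C (a : E)) ^ 2 * (X - C (b : E)))), true)}) :
            arithmeticBorel F E c 3) : (quasiSplit F E c 3).arithmeticSubgroup) : (quasiSplit F E c 3).Adelic) * y) := by
        rw [borelSumClass_def]
        exact (e.symm.tsum_eq _).symm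
    _ = ∑' p : {t : rationalTorus F E c 3 // (fun γ : (quasiSplit F E c 3).arithmeticSubgroup =>
          (((adelicVal F E c 3 _ (γ : (quasiSplit F E c 3).Adelic) :
          GL (Fin 3) (AdeleRing (𝓞 E) E)) : Matrix (Fin 3) (Fin 3) (AdeleRing (𝓞 E) E)).charpoly,
        decide (∃ δ : (quasiSplit F E c 3).arithmeticSubgroup, δ * γ * δ⁻¹ ∈ arithmeticBorel F E c 3)))
              ⟨((t : torusAdelic F E c 3) : (quasiSplit F E c 3).Adelic), t.2⟩ =
                    ((Polynomial.map (algebraMap E (AdeleRing (𝓞 E) E)) ((X - C (a : E)) ^ 2 * (X - C (b : E)))), true)} ×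
            rationalUnipotent F E c 3,
          f (x⁻¹ * (γ₀ : (quasiSplit F E c 3).Adelic) * ((p.2 : adelicUnipotent F E c 3) : (quasiSplit F E c 3).Adelic) * y) :=
        tsum_congr fun p => by rw [he p, hpt p.1]; simp only [mul_assoc]
    _ = ∑' n : rationalUnipotent F E c 3,
          f (x⁻¹ * (γ₀ : (quasiSplit F E c 3).Adelic) * ((n : adelicUnipotent F E c 3) : (quasiSplit F E c 3).Adelic) * y) :=
        (Equiv.uniqueProd (rationalUnipotent F E c 3)
          {t : rationalTorus F E c 3 // (fun γ : (quasiSplit F E c 3).arithmeticSubgroup => (((adelicVal F E c 3 _ (γ : (quasiSplit F E c 3).Adelic) :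
          GL (Fin 3) (AdeleRing (𝓞 E) E)) : Matrix (Fin 3) (Fin 3) (AdeleRing (𝓞 E) E)).charpoly,
        decide (∃ δ : (quasiSplit F E c 3).arithmeticSubgroup, δ * γ * δ⁻¹ ∈ arithmeticBorel F E c 3)))
              ⟨((t : torusAdelic F E c 3) : (quasiSplit F E c 3).Adelic), t.2⟩ =
                    ((Polynomial.map (algebraMap E (AdeleRing (𝓞 E) E)) ((X - C (a : E)) ^ 2 * (X - C (b : E)))), true)}).tsum_eq
          (fun n : rationalUnipotent F E c 3 =>
            f (x⁻¹ * (γ₀ : (quasiSplit F E c 3).Adelic) * ((n : adelicUnipotent F E c 3) : (quasiSplit F E c 3).Adelic) * y))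

variable [MeasurableSpace (adelicUnipotent F E c 3)] [BorelSpace (adelicUnipotent F E c 3)]

/-- **(R1) THE CLASS BOREL KERNEL AT THE SINGULAR BOREL CLASS**: for `f ∈ C_c(G(𝔸_F))`, a Haar measure `ν` of
`N(𝔸_F)`, a fundamental domain `𝓕` of `N(F)` and all `x, y ∈ G(𝔸_F)`,
`K_{B,i♭}(x, y) = ν(𝓕)⁻¹ · ∫_{N(𝔸_F)} f(x⁻¹ γ₀ m y) dν(m)` — Rogawski's `Σ_{γ″ ∈ 𝒪_st ∩ M} ∫_{𝐍} f(… γ″ n …) dn`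
with `𝒪_st ∩ M = {γ}` [(7.2.2)], through ★ `kernelBorelClass_eq_smul_tsum_integral` over the one-point torus
cell of §2. [cite: Rogawski1990, §2.2 (p. 13); §7.2 (pp. 91–92)] -/
theorem kernelBorelClass_singular_eq_smul_integral {a b : Eˣ} {g₀ : (quasiSplit F E c 3).Rational} {γ₀ : (quasiSplit F E c 3).arithmeticSubgroup}
    (hg₀ : ((g₀.val : GL (Fin 3) E) : Matrix (Fin 3) (Fin 3) E) = !![(a : E), 0, 0; 0, b, 0; 0, 0, a])
    (hγ₀ : (γ₀ : (quasiSplit F E c 3).Adelic) = (quasiSplit F E c 3).toAdelic g₀) (hab : (a : E) ≠ (b : E))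
    (ha : c (a : E) * (a : E) = 1) (hb : c (b : E) * (b : E) = 1)
    (ν : Measure (adelicUnipotent F E c 3)) [ν.IsHaarMeasure]
    {𝓕 : Set (adelicUnipotent F E c 3)} (h𝓕 : IsFundamentalDomain (rationalUnipotent F E c 3) 𝓕 ν)
    {f : (quasiSplit F E c 3).Adelic → ℂ} (hfc : Continuous f) (hf : HasCompactSupport f) (x y : (quasiSplit F E c 3).Adelic) :
    kernelBorelClass ν 𝓕 (fun γ : (quasiSplit F E c 3).arithmeticSubgroup => (((adelicVal F E c 3 _ (γ : (quasiSplit F E c 3).Adelic) :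
          GL (Fin 3) (AdeleRing (𝓞 E) E)) : Matrix (Fin 3) (Fin 3) (AdeleRing (𝓞 E) E)).charpoly,
        decide (∃ δ : (quasiSplit F E c 3).arithmeticSubgroup, δ * γ * δ⁻¹ ∈ arithmeticBorel F E c 3)))
              ((Polynomial.map (algebraMap E (AdeleRing (𝓞 E) E)) ((X - C (a : E)) ^ 2 * (X - C (b : E)))), true) f x y = ((ν 𝓕).toReal⁻¹ : ℝ) •
      ∫ m : adelicUnipotent F E c 3,
        f (x⁻¹ * (γ₀ : (quasiSplit F E c 3).Adelic) * ((m : adelicUnipotent F E c 3) : (quasiSplit F E c 3).Adelic) * y) ∂ν := by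
  have hclN : IsUnipotentInvariantOnBorel F E c 3 (fun γ : (quasiSplit F E c 3).arithmeticSubgroup =>
        (((adelicVal F E c 3 _ (γ : (quasiSplit F E c 3).Adelic) :
          GL (Fin 3) (AdeleRing (𝓞 E) E)) : Matrix (Fin 3) (Fin 3) (AdeleRing (𝓞 E) E)).charpoly,
        decide (∃ δ : (quasiSplit F E c 3).arithmeticSubgroup, δ * γ * δ⁻¹ ∈ arithmeticBorel F E c 3))) :=
    isUnipotentInvariantOnBorel_borelRefine isUnipotentInvariantOnBorel_charpoly_adelicVal
  obtain ⟨t₀, -⟩ := exists_torusCell_coe_eq_basePoint hg₀ hγ₀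
  haveI := subsingleton_torusCell hg₀ hγ₀ hab ha hb
  haveI : Unique {t : rationalTorus F E c 3 // (fun γ : (quasiSplit F E c 3).arithmeticSubgroup =>
        (((adelicVal F E c 3 _ (γ : (quasiSplit F E c 3).Adelic) :
          GL (Fin 3) (AdeleRing (𝓞 E) E)) : Matrix (Fin 3) (Fin 3) (AdeleRing (𝓞 E) E)).charpoly,
        decide (∃ δ : (quasiSplit F E c 3).arithmeticSubgroup, δ * γ * δ⁻¹ ∈ arithmeticBorel F E c 3)))
              ⟨((t : torusAdelic F E c 3) : (quasiSplit F E c 3).Adelic), t.2⟩ =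
                    ((Polynomial.map (algebraMap E (AdeleRing (𝓞 E) E)) ((X - C (a : E)) ^ 2 * (X - C (b : E)))), true)} :=
    uniqueOfSubsingleton t₀
  have H : kernelBorelClass ν 𝓕 (fun γ : (quasiSplit F E c 3).arithmeticSubgroup => (((adelicVal F E c 3 _ (γ : (quasiSplit F E c 3).Adelic) :
          GL (Fin 3) (AdeleRing (𝓞 E) E)) : Matrix (Fin 3) (Fin 3) (AdeleRing (𝓞 E) E)).charpoly,
        decide (∃ δ : (quasiSplit F E c 3).arithmeticSubgroup, δ * γ * δ⁻¹ ∈ arithmeticBorel F E c 3)))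
              ((Polynomial.map (algebraMap E (AdeleRing (𝓞 E) E)) ((X - C (a : E)) ^ 2 * (X - C (b : E)))), true) f x y = ((ν 𝓕).toReal⁻¹ : ℝ) •
      ∑' t : {t : rationalTorus F E c 3 // (fun γ : (quasiSplit F E c 3).arithmeticSubgroup =>
            (((adelicVal F E c 3 _ (γ : (quasiSplit F E c 3).Adelic) :
          GL (Fin 3) (AdeleRing (𝓞 E) E)) : Matrix (Fin 3) (Fin 3) (AdeleRing (𝓞 E) E)).charpoly,
        decide (∃ δ : (quasiSplit F E c 3).arithmeticSubgroup, δ * γ * δ⁻¹ ∈ arithmeticBorel F E c 3)))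
              ⟨((t : torusAdelic F E c 3) : (quasiSplit F E c 3).Adelic), t.2⟩ =
                    ((Polynomial.map (algebraMap E (AdeleRing (𝓞 E) E)) ((X - C (a : E)) ^ 2 * (X - C (b : E)))), true)},
        ∫ m : adelicUnipotent F E c 3,
          f (x⁻¹ * (((t : rationalTorus F E c 3) : torusAdelic F E c 3) : (quasiSplit F E c 3).Adelic) *
            ((m : adelicUnipotent F E c 3) : (quasiSplit F E c 3).Adelic) * y) ∂ν :=
    kernelBorelClass_eq_smul_tsum_integral ν h𝓕 hclN hfc hf x y _
  rw [H, tsum_eq_single (default : {t : rationalTorus F E c 3 //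
      (fun γ : (quasiSplit F E c 3).arithmeticSubgroup => (((adelicVal F E c 3 _ (γ : (quasiSplit F E c 3).Adelic) :
          GL (Fin 3) (AdeleRing (𝓞 E) E)) : Matrix (Fin 3) (Fin 3) (AdeleRing (𝓞 E) E)).charpoly,
        decide (∃ δ : (quasiSplit F E c 3).arithmeticSubgroup, δ * γ * δ⁻¹ ∈ arithmeticBorel F E c 3)))
              ⟨((t : torusAdelic F E c 3) : (quasiSplit F E c 3).Adelic), t.2⟩ =
                    ((Polynomial.map (algebraMap E (AdeleRing (𝓞 E) E)) ((X - C (a : E)) ^ 2 * (X - C (b : E)))), true)})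
    (fun t ht => absurd (Subsingleton.elim t default) ht),
    coe_eq_basePoint_of_borelRefine_eq hg₀ hγ₀ hab ha hb _ (default : {t : rationalTorus F E c 3 //
      (fun γ : (quasiSplit F E c 3).arithmeticSubgroup => (((adelicVal F E c 3 _ (γ : (quasiSplit F E c 3).Adelic) :
          GL (Fin 3) (AdeleRing (𝓞 E) E)) : Matrix (Fin 3) (Fin 3) (AdeleRing (𝓞 E) E)).charpoly,
        decide (∃ δ : (quasiSplit F E c 3).arithmeticSubgroup, δ * γ * δ⁻¹ ∈ arithmeticBorel F E c 3)))
              ⟨((t : torusAdelic F E c 3) : (quasiSplit F E c 3).Adelic), t.2⟩ =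
                    ((Polynomial.map (algebraMap E (AdeleRing (𝓞 E) E)) ((X - C (a : E)) ^ 2 * (X - C (b : E)))), true)}).2]

/-- The diagonal case `K_{B,i♭}(g, g) = ν(𝓕)⁻¹ · ∫_{N(𝔸_F)} f(g⁻¹ γ₀ m g) dν(m)`.
[cite: Rogawski1990, §2.2 (p. 13); §7.2 (pp. 91–92)] -/
theorem kernelBorelClass_singular_diag_eq_smul_integral {a b : Eˣ} {g₀ : (quasiSplit F E c 3).Rational} {γ₀ : (quasiSplit F E c 3).arithmeticSubgroup}
    (hg₀ : ((g₀.val : GL (Fin 3) E) : Matrix (Fin 3) (Fin 3) E) = !![(a : E), 0, 0; 0, b, 0; 0, 0, a])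
    (hγ₀ : (γ₀ : (quasiSplit F E c 3).Adelic) = (quasiSplit F E c 3).toAdelic g₀) (hab : (a : E) ≠ (b : E))
    (ha : c (a : E) * (a : E) = 1) (hb : c (b : E) * (b : E) = 1)
    (ν : Measure (adelicUnipotent F E c 3)) [ν.IsHaarMeasure]
    {𝓕 : Set (adelicUnipotent F E c 3)} (h𝓕 : IsFundamentalDomain (rationalUnipotent F E c 3) 𝓕 ν)
    {f : (quasiSplit F E c 3).Adelic → ℂ} (hfc : Continuous f) (hf : HasCompactSupport f) (g : (quasiSplit F E c 3).Adelic) :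
    kernelBorelClass ν 𝓕 (fun γ : (quasiSplit F E c 3).arithmeticSubgroup => (((adelicVal F E c 3 _ (γ : (quasiSplit F E c 3).Adelic) :
          GL (Fin 3) (AdeleRing (𝓞 E) E)) : Matrix (Fin 3) (Fin 3) (AdeleRing (𝓞 E) E)).charpoly,
        decide (∃ δ : (quasiSplit F E c 3).arithmeticSubgroup, δ * γ * δ⁻¹ ∈ arithmeticBorel F E c 3)))
              ((Polynomial.map (algebraMap E (AdeleRing (𝓞 E) E)) ((X - C (a : E)) ^ 2 * (X - C (b : E)))), true) f g g = ((ν 𝓕).toReal⁻¹ : ℝ) •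
      ∫ m : adelicUnipotent F E c 3,
        f (g⁻¹ * (γ₀ : (quasiSplit F E c 3).Adelic) * ((m : adelicUnipotent F E c 3) : (quasiSplit F E c 3).Adelic) * g) ∂ν :=
  kernelBorelClass_singular_eq_smul_integral hg₀ hγ₀ hab ha hb ν h𝓕 hfc hf g g

end BorelKernel

end UnitaryGroup

end Literature.NumberTheory.Automorphic
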